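import Mathlib.RingTheory.AdicCompletion.Basic
import Mathlib.LinearAlgebra.Matrix.NonsingularInverse
import Mathlib.NumberTheory.Padics.PadicIntegers
import Mathlib.Tactic.NoncommRing
import HarnessLib

/-!
# Hensel's lemma for `ε`-hermitian forms: over an adically complete ring with `2` invertible — or with a
# surjective trace `t + σ t = 1`, or for alternating forms with `2` arbitrary — two unimodular `ε`-hermitian matrices
# that are congruent modulo `I` are equivalent by a matrix `≡ 1 (mod I)` (Kottwitz 1992, proof of Lemma 7.2, all `p`)

Topic `LinearAlgebra/Matrix`, namespace `Literature.LinearAlgebra.Matrix.HermitianFormsHensel` (lane `lit-hodgefound`,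
Track 2 foundations; seat `lit-hodgefound-p11`, generation 32, row g32-#7).  THEOREMS ONLY (D-0026): no definition, no
named fact, no instance, no notation.  Sequel, on the integral side, of the series on isometry groups of `ε`-symmetric /
`ε`-hermitian forms `ᵀ(x^σ) J x = J` (`Automorphic/UnitaryGroupAutomorphicRep`, `LinearAlgebra/Matrix/IsometryConjugacy*`).

## The print, verbatim

R. E. Kottwitz, *Points on some Shimura varieties over finite fields*, J. Amer. Math. Soc. 5 (1992) [Kottwitz1992], §7,
Lemma 7.2 (held copy `paper:doi-10-2307-2152772`, PDF p0023 L34 – p0024 L40): «Lemma 7.2. Let `(V', (·,·)')` be a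
nondegenerate skew-Hermitian `B`-module such that `V'` is isomorphic to `V` as `B`-module. Suppose that `Λ'` is a self-dual
`𝒪_B`-lattice in `V'`. In Case D assume further that `p ≠ 2` and that […]. Then there exists an isomorphism `φ : V → V'` of
skew-Hermitian `B`-modules such that `φ(Λ) = Λ'`.»  Its proof, after identifying `Λ'` with `Λ` by a lift `φ₀` of an
isomorphism modulo `p` («it follows from Nakayama's lemma that `φ₀` is an isomorphism of `𝒪_B`-modules»), is a successive
approximation: «thus `(·,·)'` is now a second nondegenerate skew-Hermitian form on `V` for which `Λ` is self-dual, and the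
reduction of `(·,·)'` modulo `p` coincides with the reduction of `(·,·)` modulo `p`. Let `C₀` denote the maximal order
`End_{𝒪_B}(Λ)` of `C`; the involution `*` on `C` obtained from `(·,·)` preserves `C₀`. We want to find `Ψ ∈ C₀` such that
`id_Λ + pΨ` induces an isomorphism of skew-Hermitian `𝒪_B/p²𝒪_B`-modules from `(Λ/p²Λ, (·,·))` to `(Λ/p²Λ, (·,·)')`. Let `ρ`
be the unique element of `C₀` such that `(v, w)' = (ρv, w)` for all `v, w ∈ Λ`. Of course `ρ* = ρ`. The condition on `Ψ`
can be expressed as `(ρ − 1)/p ≡ Ψ + Ψ*` (modulo `p`). If `p ≠ 2`, it is obvious that this equation can be solved (take `Ψ`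
to be `½` times the symmetric element `(ρ − 1)/p` of `C₀`). If `p = 2` and we are in Case A, it is again obvious that
this equation can be solved (use that the trace map from `𝔽_{p²}` to `𝔽_p` is surjective). If `p = 2` and we are in Case C,
it is not true that the map `x ↦ x + x*` from `C₀/pC₀` to `(C₀/pC₀)^sym` is surjective; however, it is true that its image
contains `(C₀)^sym/p(C₀)^sym` […]. Continuing this process for `p², p³, …`, we eventually get `Ψ ∈ C₀` such that `id_Λ + pΨ`
is an isomorphism of skew-Hermitian `𝒪_B`-modules from `(V, (·,·))` to `(V, (·,·)')`.» (PDF p0024 L14–L24.)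

## What is formalised (the case `B = F` commutative, in coordinates, over any adically complete ring)

`R` is a commutative ring, complete and separated for the `I`-adic topology (`[IsAdicComplete I R]`), `σ : R →+* R` an
involution (`σ ∘ σ = id`, possibly `σ = id`) with `σ(I) ⊆ I`, `2 ∈ Rˣ`; the adjoint of a matrix `x` is `x† = ᵀ(x^σ)`,
written `(x.map σ)ᵀ` as in the unitary files; a form is a matrix `J` with `J† = ε • J` (`ε = 1`: hermitian / symmetric,
`ε = −1`: skew), unimodular when `det J ∈ Rˣ`; `g` transports `J'` to `g† J' g`.

* §2 **`conj_sub_mem_mul`** — ONE STEP («take `Ψ` to be `½` times the symmetric element»): if `J' − J` has entries in an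
  ideal `K` with `σ(K) ⊆ K`, then `h = 1 − ½ J⁻¹ (J' − J)` satisfies `h ≡ 1 (mod K)` and `h† J' h ≡ J (mod K²)`
  (the identity `ψ† J + J ψ = −(J' − J)` for `ψ = −½ J⁻¹(J' − J)`, so that `h† J' h − J = ψ†(J' − J) + (J' − J)ψ + ψ† J' ψ`);
  `exists_conj_sub_mem_mul` is the `∃`-form.
* §3 **`exists_conj_eq_of_sub_mem`** — THE LEMMA («continuing this process for `p², p³, …`»): if `J' ≡ J (mod I)`
  entrywise, `J` unimodular, both `ε`-hermitian, then `g† J' g = J` for some `g ≡ 1 (mod I)`; the iterates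
  `G_{m+1} = G_m · (1 − ½ J⁻¹(G_m† J' G_m − J))` satisfy `G_m† J' G_m ≡ J (mod I^{m+1})` and `G_{m+1} ≡ G_m (mod I^{m+1})`,
  converge entrywise (`IsPrecomplete`), and the limit is an exact isometry (`IsHausdorff`).
  **`isUnit_det_of_sub_one_mem`** («it follows from Nakayama's lemma that `φ₀` is an isomorphism»: `g ≡ 1 (mod I)` is
  invertible, `I` lying in the Jacobson radical), **`exists_isometry_of_sub_mem`** (the same `g` with `det g ∈ Rˣ`), and
  **`exists_isometry_of_conj_sub_mem`** (the printed two-stage form: if some `g₀` transports `J'` to `J` MODULO `I`, then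
  some `g ≡ g₀ (mod I)` with `det g ∈ Rˣ` transports `J'` to `J` exactly).
* §4 `σ = id` (bilinear forms, Cases C/D): `exists_isometry_of_sub_mem_transpose`, `exists_isometry_of_conj_sub_mem_transpose`;
  and over `ℤ_p`, `p ≠ 2` (Kottwitz's setting with `B = ℚ_p`): **`exists_isometry_padicInt`**,
  `exists_isometry_padicInt_of_conj_dvd` — two unimodular `ε`-symmetric matrices over `ℤ_p` that are congruent modulo `p`,
  or `GL_n(ℤ_p)`-equivalent modulo `p`, are `GL_n(ℤ_p)`-equivalent.

* §6 **`exists_conj_eq_of_forall_step`** — THE ITERATION ABSTRACTLY: for any property `P` of forms stable under transport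
  and any solver of ONE STEP (`X ≡ J (mod K)`, `P X` ⟹ some `h ≡ 1 (mod K)` with `h† X h ≡ J (mod K²)`, for all ideals
  `K` with `σ(K) ⊆ K`), `J' ≡ J (mod I)` gives `g† J' g = J` with `g ≡ 1 (mod I)` — the three printed cases differ only
  in the step.
* §7 THE STEP UNDER A SURJECTIVE TRACE (Case A at `p = 2`: «use that the trace map from `𝔽_{p²}` to `𝔽_p` is surjective»):
  with `t + σ t = 1` in place of `½`, **`conj_sub_mem_mul_of_trace`** (`ψ = −t J⁻¹(J' − J)` has `ψ† J = −σ(t)(J' − J)`,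
  `J ψ = −t(J' − J)`), **`exists_conj_eq_of_sub_mem_of_trace`**, `exists_isometry_of_sub_mem_of_trace`,
  `exists_isometry_of_conj_sub_mem_of_trace` (no hypothesis on `2`); when the trace hits `1`:
  `exists_add_map_eq_one_of_isUnit_two` (`t = ½`), **`exists_add_map_eq_one_of_isUnit_add`** (as soon as some `a + σ a`
  is a unit), **`exists_add_map_eq_one_of_isUnit_sub`** (`R` local and `σ a − a ∈ Rˣ` for some `a`, i.e. `σ ≠ id` on the
  residue field — the unramified dyadic case), `exists_add_prodComm_eq_one` (the split algebra `A × A` with the swap).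
* §8 THE STEP FOR ALTERNATING FORMS, `2` ARBITRARY (Case C at `p = 2`: «its image contains `(C₀)^sym/p(C₀)^sym`»): the
  difference of two alternating matrices is `N − ᵀN`, and `ψ = J⁻¹ ᵀN` solves the step exactly —
  **`exists_conj_sub_mem_mul_of_alternating`**, **`exists_conj_eq_of_sub_mem_of_alternating`**,
  `exists_isometry_of_sub_mem_of_alternating`, `exists_isometry_of_conj_sub_mem_of_alternating`, and over `ℤ_p` for ALL
  `p`: **`exists_isometry_padicInt_of_alternating`**, `exists_isometry_padicInt_of_alternating_of_conj_dvd`.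

Not formalised: the non-commutative `B` (general `𝒪_B`-lattices; for `𝒪_B = M_n(𝒪_F)` Morita-equivalent to the case
treated), and the Lang-theorem input that any two nondegenerate forms modulo `p` are equivalent (for alternating forms
over a local ring this is `AlternatingCongruenceLocalRing.exists_conj_eq`, any residue characteristic).  Knebusch
[Knebusch2010] Ch. 1 §1.3 Lemma 1.16 (held copy, PDF p0020) reaches the symmetric case over a local ring by lifting
orthogonal bases instead; we follow Kottwitz's Newton iteration, which needs no diagonalisation and covers `σ ≠ id` and
`ε = −1` uniformly.

## References

* [Kottwitz1992] R. E. Kottwitz, *Points on some Shimura varieties over finite fields*, J. Amer. Math. Soc. 5 (1992)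
  373–444, §7 Lemma 7.2 and its proof, pp. 395–396.
* [Knebusch2010] M. Knebusch, *Specialization of Quadratic and Symmetric Bilinear Forms*, Springer (2010), Ch. 1, Lemma 1.16.
* [Serre1979] J.-P. Serre, *Local Fields*, GTM 67, Springer (1979), Ch. V §2 (trace and norm in unramified extensions).
-/

open scoped Matrix

namespace Literature.LinearAlgebra.Matrix.HermitianFormsHensel

variable {R : Type*} [CommRing R] {n : Type*}

/-! ## §1 Matrices with entries in an ideal; adjoints `x† = ᵀ(x^σ)` -/

section Entries

variable {I K : Ideal R}

/-- [folklore] entries in an ideal: closed under addition. -/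
private theorem ent_add {M N : Matrix n n R} (hM : ∀ i j, M i j ∈ I) (hN : ∀ i j, N i j ∈ I) :
    ∀ i j, (M + N) i j ∈ I := fun i j => by
  rw [Matrix.add_apply]
  exact I.add_mem (hM i j) (hN i j)

/-- [folklore] entries in an ideal: closed under negation. -/
private theorem ent_neg {M : Matrix n n R} (hM : ∀ i j, M i j ∈ I) : ∀ i j, (-M) i j ∈ I := fun i j => by
  rw [Matrix.neg_apply]
  exact I.neg_mem (hM i j)

/-- [folklore] entries in an ideal: closed under scalars. -/
private theorem ent_smul (a : R) {M : Matrix n n R} (hM : ∀ i j, M i j ∈ I) : ∀ i j, (a • M) i j ∈ I :=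
  fun i j => by
  rw [Matrix.smul_apply, smul_eq_mul]
  exact I.mul_mem_left a (hM i j)

/-- [folklore] entries in an ideal: a left ideal of the matrix ring. -/
private theorem ent_mul_left [Fintype n] (A : Matrix n n R) {M : Matrix n n R} (hM : ∀ i j, M i j ∈ I) :
    ∀ i j, (A * M) i j ∈ I := fun i j => by
  rw [Matrix.mul_apply]
  exact I.sum_mem fun k _ => I.mul_mem_left _ (hM k j)

/-- [folklore] entries in an ideal: a right ideal of the matrix ring (`R` commutative). -/
private theorem ent_mul_right [Fintype n] (A : Matrix n n R) {M : Matrix n n R} (hM : ∀ i j, M i j ∈ I) :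
    ∀ i j, (M * A) i j ∈ I := fun i j => by
  rw [Matrix.mul_apply]
  exact I.sum_mem fun k _ => I.mul_mem_right _ (hM i k)

/-- [folklore] `M_n(I) · M_n(K) ⊆ M_n(I K)`. -/
private theorem ent_mul_mul [Fintype n] {M N : Matrix n n R} (hM : ∀ i j, M i j ∈ I) (hN : ∀ i j, N i j ∈ K) :
    ∀ i j, (M * N) i j ∈ I * K := fun i j => by
  rw [Matrix.mul_apply]
  exact (I * K).sum_mem fun k _ => Ideal.mul_mem_mul (hM i k) (hN k j)

/-- [folklore] entries in an ideal: transpose. -/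
private theorem ent_transpose {M : Matrix n n R} (hM : ∀ i j, M i j ∈ I) : ∀ i j, Mᵀ i j ∈ I :=
  fun i j => hM j i

/-- [folklore] entries in an ideal: applying a ring endomorphism preserving the ideal. -/
private theorem ent_map (σ : R →+* R) (hσ : ∀ a ∈ I, σ a ∈ I) {M : Matrix n n R} (hM : ∀ i j, M i j ∈ I) :
    ∀ i j, (M.map σ) i j ∈ I := fun i j => hσ _ (hM i j)

/-- [folklore] entries in an ideal: monotone in the ideal. -/
private theorem ent_mono (h : I ≤ K) {M : Matrix n n R} (hM : ∀ i j, M i j ∈ I) : ∀ i j, M i j ∈ K :=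
  fun i j => h (hM i j)

/-- [folklore] a ring endomorphism preserving `I` preserves every power `I ^ m`. -/
private theorem map_mem_pow (σ : R →+* R) (hσI : ∀ a ∈ I, σ a ∈ I) (m : ℕ) :
    ∀ a ∈ I ^ m, σ a ∈ I ^ m := by
  intro a ha
  have h1 : Ideal.map σ I ≤ I := Ideal.map_le_iff_le_comap.2 fun x hx => hσI x hx
  have h2 : Ideal.map σ (I ^ m) ≤ I ^ m := by
    rw [Ideal.map_pow]
    exact Ideal.pow_right_mono h1 m
  exact h2 (Ideal.mem_map_of_mem σ ha)

/-- [folklore] in `R` as a module over itself, `x ≡ y (SMOD I^m • ⊤)` is `x − y ∈ I^m`. -/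
private theorem smodEq_iff {m : ℕ} {x y : R} : x ≡ y [SMOD (I ^ m • ⊤ : Submodule R R)] ↔ x - y ∈ I ^ m := by
  rw [SModEq.sub_mem, smul_eq_mul, Ideal.mul_top]

end Entries

section Adjoint

variable (σ : R →+* R)

/-- [folklore] `(A B)† = B† A†`. -/
private theorem adj_mul [Fintype n] (A B : Matrix n n R) : ((A * B).map σ)ᵀ = (B.map σ)ᵀ * (A.map σ)ᵀ := by
  rw [Matrix.map_mul, Matrix.transpose_mul]

/-- [folklore] `(A + B)† = A† + B†`. -/
private theorem adj_add (A B : Matrix n n R) : ((A + B).map σ)ᵀ = (A.map σ)ᵀ + (B.map σ)ᵀ := by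
  rw [Matrix.map_add _ (map_add σ), Matrix.transpose_add]

/-- [folklore] `(A − B)† = A† − B†`. -/
private theorem adj_sub (A B : Matrix n n R) : ((A - B).map σ)ᵀ = (A.map σ)ᵀ - (B.map σ)ᵀ := by
  rw [Matrix.map_sub _ (map_sub σ), Matrix.transpose_sub]

/-- [folklore] `1† = 1`. -/
private theorem adj_one [DecidableEq n] : ((1 : Matrix n n R).map σ)ᵀ = 1 := by
  rw [Matrix.map_one _ (map_zero σ) (map_one σ), Matrix.transpose_one]

/-- [folklore] the difference of two `ε`-hermitian matrices is `ε`-hermitian. -/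
private theorem adj_sub_eq {ε : R} {J J₁ : Matrix n n R} (hJε : (J.map σ)ᵀ = ε • J)
    (hJ₁ε : (J₁.map σ)ᵀ = ε • J₁) : ((J₁ - J).map σ)ᵀ = ε • (J₁ - J) := by
  rw [adj_sub, hJε, hJ₁ε, smul_sub]

/-- [folklore] for a unimodular `ε`-hermitian `J`: `ε · (J⁻¹)† J = 1`. -/
private theorem smul_adj_inv_mul [Fintype n] [DecidableEq n] {ε : R} {J : Matrix n n R} (hJ : IsUnit J.det) (hJε : (J.map σ)ᵀ = ε • J) :
    ε • ((J⁻¹.map σ)ᵀ * J) = 1 := by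
  rw [← Matrix.mul_smul, ← hJε, ← Matrix.transpose_mul, ← Matrix.map_mul, Matrix.mul_nonsing_inv _ hJ, adj_one]

/-- [folklore] transport preserves `ε`-hermitianness when `σ` is an involution: `(A† X A)† = ε • A† X A`. -/
private theorem adj_conj [Fintype n] (hσ : ∀ a, σ (σ a) = a) {ε : R} {X : Matrix n n R} (hX : (X.map σ)ᵀ = ε • X)
    (A : Matrix n n R) : (((A.map σ)ᵀ * X * A).map σ)ᵀ = ε • ((A.map σ)ᵀ * X * A) := by
  have hσσ : (σ : R → R) ∘ (σ : R → R) = id := funext hσ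
  have hAA : ((A.map σ)ᵀ.map σ)ᵀ = A := by
    rw [Matrix.transpose_map, Matrix.transpose_transpose, Matrix.map_map, hσσ, Matrix.map_id]
  rw [adj_mul, adj_mul, hAA, hX]
  simp only [Matrix.mul_assoc, Matrix.mul_smul, Matrix.smul_mul]

end Adjoint

/-! ## §2 One step: `ψ = −½ J⁻¹(J' − J)` solves `ψ† J + J ψ = −(J' − J)`, so `(1 + ψ)† J' (1 + ψ) ≡ J (mod K²)` -/

section Step

variable [Fintype n] [DecidableEq n] (σ : R →+* R) {K : Ideal R}

/-- **The approximation step** («the condition on `Ψ` can be expressed as `(ρ − 1)/p ≡ Ψ + Ψ*` (modulo `p`). If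
`p ≠ 2`, it is obvious that this equation can be solved (take `Ψ` to be `½` times the symmetric element
`(ρ − 1)/p`)»), in coordinates and for an arbitrary ideal `K` with `σ(K) ⊆ K` in place of `(p)`: if `J` is unimodular,
`J`, `J'` are `ε`-hermitian and `J' ≡ J (mod K)` entrywise, then with `2u = 1` the matrix `h = 1 − u · J⁻¹(J' − J)`
satisfies `h† J' h ≡ J (mod K²)` entrywise.  (Identity: for `ψ = h − 1` one has `ψ† J + J ψ = −(J' − J)`, whence
`h† J' h − J = ψ†(J' − J) + (J' − J)ψ + ψ† J' ψ`, each term a product of two matrices with entries in `K`.)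
[cite: Kottwitz1992, §7, proof of Lemma 7.2, p. 396] -/
theorem conj_sub_mem_mul (hσK : ∀ a ∈ K, σ a ∈ K) {u : R} (hu : 2 * u = 1) {ε : R} {J J' : Matrix n n R}
    (hJ : IsUnit J.det) (hJε : (J.map σ)ᵀ = ε • J) (hJ'ε : (J'.map σ)ᵀ = ε • J')
    (hD : ∀ i j, (J' - J) i j ∈ K) (i j : n) :
    (((1 - u • (J⁻¹ * (J' - J))).map σ)ᵀ * J' * (1 - u • (J⁻¹ * (J' - J))) - J) i j ∈ K * K := by
  set D := J' - J with hD_def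
  set ψ : Matrix n n R := -(u • (J⁻¹ * D)) with hψ_def
  have hh : (1 : Matrix n n R) - u • (J⁻¹ * D) = 1 + ψ := by rw [hψ_def, sub_eq_add_neg]
  have hσu : σ u = u := by
    have h := congrArg σ hu
    rw [map_mul, map_ofNat, map_one] at h
    calc σ u = σ u * (2 * u) := by rw [hu, mul_one]
      _ = 2 * σ u * u := by ring
      _ = u := by rw [h, one_mul]
  have hDadj : (D.map σ)ᵀ = ε • D := adj_sub_eq σ hJε hJ'ε
  have hW : ε • ((J⁻¹.map σ)ᵀ * J) = 1 := smul_adj_inv_mul σ hJ hJε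
  -- entries of `ψ` and `ψ†`
  have hψK : ∀ i j, ψ i j ∈ K := ent_neg (ent_smul u (ent_mul_left J⁻¹ hD))
  have hψadjK : ∀ i j, (ψ.map σ)ᵀ i j ∈ K := ent_transpose (ent_map σ hσK hψK)
  -- the two halves of `ψ† J + J ψ = -D`
  have hJψ : J * ψ = -(u • D) := by
    rw [hψ_def, Matrix.mul_neg, Matrix.mul_smul, ← Matrix.mul_assoc, Matrix.mul_nonsing_inv _ hJ, Matrix.one_mul]
  have hψJ : (ψ.map σ)ᵀ * J = -(u • D) := by
    have e1 : ψ.map σ = -(σ u • (J⁻¹.map σ * D.map σ)) := by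
      rw [hψ_def, Matrix.map_neg _ (map_neg σ), Matrix.map_smul' _ _ _ (map_mul σ), Matrix.map_mul]
    rw [e1, Matrix.transpose_neg, Matrix.transpose_smul, Matrix.transpose_mul, hσu, hDadj]
    simp only [Matrix.neg_mul, Matrix.smul_mul, Matrix.mul_assoc]
    rw [← Matrix.mul_smul, hW, Matrix.mul_one]
  have hsum : (ψ.map σ)ᵀ * J + J * ψ = -D := by
    rw [hψJ, hJψ, ← neg_add, ← add_smul, ← two_mul, hu, one_smul]
  -- the identity
  have hid : ((1 + ψ).map σ)ᵀ * J' * (1 + ψ) - J = (ψ.map σ)ᵀ * D + D * ψ + (ψ.map σ)ᵀ * J' * ψ := by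
    have hJ' : J' = J + D := by rw [hD_def]; abel
    rw [adj_add, adj_one, hJ']
    have key : (1 + (ψ.map σ)ᵀ) * (J + D) * (1 + ψ) - J =
        ((ψ.map σ)ᵀ * J + J * ψ) + D + ((ψ.map σ)ᵀ * D + D * ψ + (ψ.map σ)ᵀ * (J + D) * ψ) := by
      noncomm_ring
    rw [key, hsum, neg_add_cancel, zero_add]
  rw [hh, hid]
  exact ent_add (ent_add (ent_mul_mul hψadjK hD) (ent_mul_mul hD hψK)) (ent_mul_mul (ent_mul_right J' hψadjK) hψK) i j

/-- **The approximation step, `∃`-form**: with `2 ∈ Rˣ`, `J` unimodular, `J, J'` `ε`-hermitian and `J' ≡ J (mod K)`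
there is `ψ` with entries in `K` such that `(1 + ψ)† J' (1 + ψ) ≡ J (mod K²)`.
[cite: Kottwitz1992, §7, proof of Lemma 7.2, p. 396] -/
theorem exists_conj_sub_mem_mul (hσK : ∀ a ∈ K, σ a ∈ K) (h2 : IsUnit (2 : R)) {ε : R} {J J' : Matrix n n R}
    (hJ : IsUnit J.det) (hJε : (J.map σ)ᵀ = ε • J) (hJ'ε : (J'.map σ)ᵀ = ε • J')
    (hD : ∀ i j, (J' - J) i j ∈ K) :
    ∃ ψ : Matrix n n R, (∀ i j, ψ i j ∈ K) ∧
      ∀ i j, (((1 + ψ).map σ)ᵀ * J' * (1 + ψ) - J) i j ∈ K * K := by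
  obtain ⟨u, hu⟩ := h2.exists_right_inv
  refine ⟨-(u • (J⁻¹ * (J' - J))), ent_neg (ent_smul u (ent_mul_left J⁻¹ hD)), fun i j => ?_⟩
  rw [← sub_eq_add_neg]
  exact conj_sub_mem_mul σ hσK hu hJ hJε hJ'ε hD i j

end Step

/-! ## §3 The limit: `g† J' g = J` with `g ≡ 1 (mod I)` over an `I`-adically complete ring -/

section Limit

variable [Fintype n] [DecidableEq n] {I : Ideal R} [IsAdicComplete I R] (σ : R →+* R)

/-- **Hensel's lemma for `ε`-hermitian forms** («Continuing this process for `p², p³, …`, we eventually get `Ψ ∈ C₀` such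
that `id_Λ + pΨ` is an isomorphism of skew-Hermitian modules from `(V, (·,·))` to `(V, (·,·)')`»), in coordinates: `R`
complete and separated in the `I`-adic topology, `σ` an involution of `R` with `σ(I) ⊆ I`, `2 ∈ Rˣ`; if `J` is
unimodular, `J† = εJ`, `J'† = εJ'` and `J' ≡ J (mod I)` entrywise, then `g† J' g = J` for some `g ≡ 1 (mod I)`.
(The iterates `G₀ = 1`, `G_{m+1} = G_m (1 − ½ J⁻¹ (G_m† J' G_m − J))` satisfy `G_m† J' G_m ≡ J (mod I^{m+1})` and
`G_{m+1} ≡ G_m (mod I^{m+1})`; their entrywise limit `g` has `g† J' g − J ∈ ⋂_m M_n(I^m) = 0`.)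
[cite: Kottwitz1992, §7, Lemma 7.2 and its proof, pp. 395–396] -/
theorem exists_conj_eq_of_sub_mem (hσ : ∀ a, σ (σ a) = a) (hσI : ∀ a ∈ I, σ a ∈ I) (h2 : IsUnit (2 : R))
    {ε : R} {J J' : Matrix n n R} (hJ : IsUnit J.det) (hJε : (J.map σ)ᵀ = ε • J)
    (hJ'ε : (J'.map σ)ᵀ = ε • J') (hJJ' : ∀ i j, (J' - J) i j ∈ I) :
    ∃ g : Matrix n n R, (∀ i j, (g - 1) i j ∈ I) ∧ (g.map σ)ᵀ * J' * g = J := by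
  obtain ⟨u, hu⟩ := h2.exists_right_inv
  -- the transported form `F g = g† J' g` and the correction factor `Φ X = 1 - u J⁻¹ (X - J)`
  obtain ⟨F, hF⟩ : ∃ F : Matrix n n R → Matrix n n R, ∀ g, F g = (g.map σ)ᵀ * J' * g := ⟨_, fun _ => rfl⟩
  obtain ⟨Φ, hΦ⟩ : ∃ Φ : Matrix n n R → Matrix n n R, ∀ X, Φ X = 1 - u • (J⁻¹ * (X - J)) :=
    ⟨_, fun _ => rfl⟩
  obtain ⟨G, hG0, hGs⟩ : ∃ G : ℕ → Matrix n n R, G 0 = 1 ∧ ∀ m, G (m + 1) = G m * Φ (F (G m)) :=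
    ⟨fun m => Nat.rec (motive := fun _ => Matrix n n R) 1 (fun _ g => g * Φ (F g)) m, rfl, fun _ => rfl⟩
  have hF_mul : ∀ g h : Matrix n n R, F (g * h) = (h.map σ)ᵀ * F g * h := by
    intro g h
    simp only [hF, adj_mul, Matrix.mul_assoc]
  -- invariants of the iteration
  have hherm : ∀ m, ((F (G m)).map σ)ᵀ = ε • F (G m) := fun m => by
    rw [hF]
    exact adj_conj σ hσ hJ'ε (G m)
  have hcong : ∀ m, ∀ i j, (F (G m) - J) i j ∈ I ^ (m + 1) := by
    intro m
    induction m with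
    | zero =>
      intro i j
      rw [hG0, hF, adj_one, Matrix.one_mul, Matrix.mul_one, zero_add, pow_one]
      exact hJJ' i j
    | succ m ih =>
      intro i j
      rw [hGs, hF_mul, hΦ]
      have hle : I ^ (m + 1) * I ^ (m + 1) ≤ I ^ (m + 1 + 1) := by
        rw [← pow_add]
        exact Ideal.pow_le_pow_right (by omega)
      exact hle (conj_sub_mem_mul σ (map_mem_pow σ hσI (m + 1)) hu hJ hJε (hherm m) ih i j)
  have hdiff : ∀ m, ∀ i j, (G (m + 1) - G m) i j ∈ I ^ (m + 1) := by
    intro m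
    have e : G (m + 1) - G m = -(G m * (u • (J⁻¹ * (F (G m) - J)))) := by
      rw [hGs, hΦ, Matrix.mul_sub, Matrix.mul_one, sub_sub_cancel_left]
    rw [e]
    exact ent_neg (ent_mul_left _ (ent_smul _ (ent_mul_left _ (hcong m))))
  -- the Cauchy estimate `G (m + k) ≡ G m (mod I^(m+1))`
  have hcauchy : ∀ m k, ∀ i j, (G (m + k) - G m) i j ∈ I ^ (m + 1) := by
    intro m k
    induction k with
    | zero =>
      intro i j
      rw [add_zero, sub_self, Matrix.zero_apply]
      exact Ideal.zero_mem _
    | succ k ih =>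
      have e : G (m + (k + 1)) - G m = (G (m + k + 1) - G (m + k)) + (G (m + k) - G m) := by
        rw [← add_assoc, sub_add_sub_cancel]
      rw [e]
      exact ent_add (ent_mono (Ideal.pow_le_pow_right (by omega)) (hdiff (m + k))) ih
  -- the entrywise limit
  have hlim : ∀ i j, ∃ l : R, ∀ m, G m i j - l ∈ I ^ m := by
    intro i j
    obtain ⟨l, hl⟩ := IsPrecomplete.prec' (I := I) (fun m => G m i j) (fun {m k} hmk => by
      obtain ⟨d, rfl⟩ := Nat.exists_eq_add_of_le hmk
      rw [smodEq_iff, ← neg_sub, neg_mem_iff, ← Matrix.sub_apply]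
      exact Ideal.pow_le_pow_right (Nat.le_succ m) (hcauchy m d i j))
    exact ⟨l, fun m => smodEq_iff.1 (hl m)⟩
  choose l hl using hlim
  have happrox : ∀ m, ∀ i j, (Matrix.of l - G m) i j ∈ I ^ m := by
    intro m i j
    rw [Matrix.sub_apply, Matrix.of_apply, ← neg_sub, neg_mem_iff]
    exact hl i j m
  refine ⟨Matrix.of l, ?_, ?_⟩
  · -- `g ≡ 1 (mod I)`
    have e : Matrix.of l - 1 = (Matrix.of l - G 1) + (G (0 + 1) - G 0) := by
      rw [zero_add, hG0, sub_add_sub_cancel]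
    rw [e]
    exact ent_add (ent_mono (by rw [pow_one]) (happrox 1)) (ent_mono (by rw [zero_add, pow_one]) (hdiff 0))
  · -- `g† J' g = J` exactly, by separatedness
    ext i j
    rw [← sub_eq_zero, ← Matrix.sub_apply]
    refine IsHausdorff.haus' (I := I) _ fun m => ?_
    rw [SModEq.zero, smul_eq_mul, Ideal.mul_top]
    have key : ((Matrix.of l).map σ)ᵀ * J' * Matrix.of l - J = (F (G m) - J) +
        (((Matrix.of l - G m).map σ)ᵀ * J' * Matrix.of l + ((G m).map σ)ᵀ * J' * (Matrix.of l - G m)) := by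
      rw [hF, adj_sub]
      noncomm_ring
    rw [key]
    exact ent_add (ent_mono (Ideal.pow_le_pow_right (Nat.le_succ m)) (hcong m))
      (ent_add (ent_mul_right _ (ent_mul_right _ (ent_transpose (ent_map σ (map_mem_pow σ hσI m) (happrox m)))))
        (ent_mul_left _ (happrox m))) i j

omit [IsAdicComplete I R] in
/-- **A matrix `≡ 1 (mod I)` is invertible when `I` lies in the Jacobson radical** — in particular over an `I`-adically
complete ring («it follows from Nakayama's lemma that `φ₀` is an isomorphism»): `det g ≡ det 1 = 1 (mod I)` and
`1 + I ⊆ Rˣ`. [cite: Kottwitz1992, §7, proof of Lemma 7.2, p. 395] -/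
theorem isUnit_det_of_sub_one_mem_of_le_jacobson (hI : I ≤ (⊥ : Ideal R).jacobson) {g : Matrix n n R}
    (hg : ∀ i j, (g - 1) i j ∈ I) : IsUnit g.det := by
  have h1 : g.map (Ideal.Quotient.mk I) = 1 := by
    ext i j
    have h := (Ideal.Quotient.eq (I := I)).2 (hg i j)
    rw [Matrix.map_apply, h, Matrix.one_apply, Matrix.one_apply]
    split_ifs
    · exact map_one _
    · exact map_zero _
  have h2 : Ideal.Quotient.mk I g.det = 1 := by
    rw [RingHom.map_det, RingHom.mapMatrix_apply, h1, Matrix.det_one]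
  have h3 : g.det - 1 ∈ I := by
    rw [← Ideal.Quotient.eq, h2, map_one]
  have h4 := Ideal.mem_jacobson_bot.1 (hI h3) 1
  rwa [mul_one, sub_add_cancel] at h4

/-- **A matrix `≡ 1 (mod I)` over an `I`-adically complete ring is invertible** (`I ⊆` Jacobson radical).
[cite: Kottwitz1992, §7, proof of Lemma 7.2, p. 395] -/
theorem isUnit_det_of_sub_one_mem {g : Matrix n n R} (hg : ∀ i j, (g - 1) i j ∈ I) : IsUnit g.det :=
  isUnit_det_of_sub_one_mem_of_le_jacobson (IsAdicComplete.le_jacobson_bot I) hg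

/-- **Hensel's lemma for `ε`-hermitian forms, with invertibility**: under the hypotheses of `exists_conj_eq_of_sub_mem`
there is `g ∈ GL_n(R)`, `g ≡ 1 (mod I)`, with `g† J' g = J` — «`id_Λ + pΨ` is an isomorphism of skew-Hermitian
`𝒪_B`-modules from `(V, (·,·))` to `(V, (·,·)')`». [cite: Kottwitz1992, §7, Lemma 7.2 and its proof, pp. 395–396] -/
theorem exists_isometry_of_sub_mem (hσ : ∀ a, σ (σ a) = a) (hσI : ∀ a ∈ I, σ a ∈ I) (h2 : IsUnit (2 : R))
    {ε : R} {J J' : Matrix n n R} (hJ : IsUnit J.det) (hJε : (J.map σ)ᵀ = ε • J)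
    (hJ'ε : (J'.map σ)ᵀ = ε • J') (hJJ' : ∀ i j, (J' - J) i j ∈ I) :
    ∃ g : Matrix n n R, IsUnit g.det ∧ (∀ i j, (g - 1) i j ∈ I) ∧ (g.map σ)ᵀ * J' * g = J := by
  obtain ⟨g, hg1, hgJ⟩ := exists_conj_eq_of_sub_mem σ hσ hσI h2 hJ hJε hJ'ε hJJ'
  exact ⟨g, isUnit_det_of_sub_one_mem hg1, hg1, hgJ⟩

/-- **Lemma 7.2 in its printed two-stage form** (first «choose an isomorphism `Λ/pΛ → Λ'/pΛ'` of skew-Hermitian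
modules … there exists an `𝒪_B`-module map `φ₀` whose reduction modulo `p` is it», then correct `φ₀` by the iteration):
if `J` is unimodular, `J`, `J'` are `ε`-hermitian, and some `g₀ ∈ M_n(R)` transports `J'` to `J` MODULO `I`
(`g₀† J' g₀ ≡ J`), then some `g ≡ g₀ (mod I)` with `det g ∈ Rˣ` transports `J'` to `J` exactly: `g† J' g = J`.
[cite: Kottwitz1992, §7, Lemma 7.2 and its proof, pp. 395–396] -/
theorem exists_isometry_of_conj_sub_mem (hσ : ∀ a, σ (σ a) = a) (hσI : ∀ a ∈ I, σ a ∈ I) (h2 : IsUnit (2 : R))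
    {ε : R} {J J' : Matrix n n R} (hJ : IsUnit J.det) (hJε : (J.map σ)ᵀ = ε • J)
    (hJ'ε : (J'.map σ)ᵀ = ε • J') {g₀ : Matrix n n R} (hg₀ : ∀ i j, ((g₀.map σ)ᵀ * J' * g₀ - J) i j ∈ I) :
    ∃ g : Matrix n n R, IsUnit g.det ∧ (∀ i j, (g - g₀) i j ∈ I) ∧ (g.map σ)ᵀ * J' * g = J := by
  obtain ⟨h, hh1, hhJ⟩ := exists_conj_eq_of_sub_mem σ hσ hσI h2 hJ hJε (adj_conj σ hσ hJ'ε g₀) hg₀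
  have e : ((g₀ * h).map σ)ᵀ * J' * (g₀ * h) = J := by
    rw [← hhJ]
    simp only [adj_mul, Matrix.mul_assoc]
  refine ⟨g₀ * h, ?_, ?_, e⟩
  · have hd := congrArg Matrix.det e
    rw [Matrix.det_mul, Matrix.det_mul] at hd
    have hu : IsUnit (((g₀ * h).map σ)ᵀ.det * J'.det * (g₀ * h).det) := by rw [hd]; exact hJ
    exact isUnit_of_mul_isUnit_right hu
  · have e2 : g₀ * h - g₀ = g₀ * (h - 1) := by rw [Matrix.mul_sub, Matrix.mul_one]
    rw [e2]
    exact ent_mul_left _ hh1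

end Limit

/-! ## §4 Bilinear forms (`σ = id`): symmetric / alternating matrices; the ring `ℤ_p`, `p ≠ 2` -/

section Bilinear

variable [Fintype n] [DecidableEq n] {I : Ideal R} [IsAdicComplete I R]

omit [Fintype n] [DecidableEq n] in
/-- [folklore] `M.map id = M` for the identity ring endomorphism. -/
private theorem map_ringHom_id (M : Matrix n n R) : M.map (RingHom.id R) = M := by
  ext i j
  rfl

/-- **Hensel's lemma for `ε`-symmetric bilinear forms** (`σ = id`: Kottwitz's Cases C, `ε = −1`, and D, `ε = 1`, with
`B = F`): over an `I`-adically complete ring with `2 ∈ Rˣ`, if `J` is unimodular, `ᵀJ = εJ`, `ᵀJ' = εJ'` and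
`J' ≡ J (mod I)` entrywise, then `ᵀg J' g = J` for some `g ∈ GL_n(R)` with `g ≡ 1 (mod I)`.
[cite: Kottwitz1992, §7, Lemma 7.2 and its proof, pp. 395–396] -/
theorem exists_isometry_of_sub_mem_transpose (h2 : IsUnit (2 : R)) {ε : R} {J J' : Matrix n n R}
    (hJ : IsUnit J.det) (hJε : Jᵀ = ε • J) (hJ'ε : J'ᵀ = ε • J') (hJJ' : ∀ i j, (J' - J) i j ∈ I) :
    ∃ g : Matrix n n R, IsUnit g.det ∧ (∀ i j, (g - 1) i j ∈ I) ∧ gᵀ * J' * g = J := by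
  obtain ⟨g, hgu, hg1, hgJ⟩ := exists_isometry_of_sub_mem (RingHom.id R) (fun _ => rfl) (fun _ h => h) h2 hJ
    (by rw [map_ringHom_id]; exact hJε) (by rw [map_ringHom_id]; exact hJ'ε) hJJ'
  rw [map_ringHom_id] at hgJ
  exact ⟨g, hgu, hg1, hgJ⟩

/-- **Two-stage form for bilinear forms**: if some `g₀` transports `J'` to `J` modulo `I` (`ᵀg₀ J' g₀ ≡ J`), `J`
unimodular, both `ε`-symmetric, `2 ∈ Rˣ`, then `ᵀg J' g = J` for some `g ∈ GL_n(R)` with `g ≡ g₀ (mod I)`.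
[cite: Kottwitz1992, §7, Lemma 7.2 and its proof, pp. 395–396] -/
theorem exists_isometry_of_conj_sub_mem_transpose (h2 : IsUnit (2 : R)) {ε : R} {J J' : Matrix n n R}
    (hJ : IsUnit J.det) (hJε : Jᵀ = ε • J) (hJ'ε : J'ᵀ = ε • J') {g₀ : Matrix n n R}
    (hg₀ : ∀ i j, (g₀ᵀ * J' * g₀ - J) i j ∈ I) :
    ∃ g : Matrix n n R, IsUnit g.det ∧ (∀ i j, (g - g₀) i j ∈ I) ∧ gᵀ * J' * g = J := by
  obtain ⟨g, hgu, hg1, hgJ⟩ := exists_isometry_of_conj_sub_mem (RingHom.id R) (fun _ => rfl) (fun _ h => h) h2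
    hJ (by rw [map_ringHom_id]; exact hJε) (by rw [map_ringHom_id]; exact hJ'ε)
    (g₀ := g₀) (by rw [map_ringHom_id]; exact hg₀)
  rw [map_ringHom_id] at hgJ
  exact ⟨g, hgu, hg1, hgJ⟩

end Bilinear

section PadicInt

variable [Fintype n] [DecidableEq n] {p : ℕ} [Fact p.Prime]

/-- [folklore] `2` is a unit of `ℤ_p` for `p ≠ 2`. -/
private theorem isUnit_two_padicInt (hp : p ≠ 2) : IsUnit (2 : ℤ_[p]) := by
  rw [PadicInt.isUnit_iff]
  refine le_antisymm (PadicInt.norm_le_one _) (not_lt.1 fun h => ?_)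
  have h' : ‖((2 : ℕ) : ℤ_[p])‖ < 1 := by rwa [Nat.cast_ofNat]
  rw [PadicInt.norm_natCast_lt_one_iff] at h'
  exact hp ((Nat.prime_dvd_prime_iff_eq (Fact.out : p.Prime) Nat.prime_two).1 h')

/-- [folklore] membership in the maximal ideal of `ℤ_p` is divisibility by `p`. -/
private theorem mem_maximalIdeal_padicInt_iff {x : ℤ_[p]} :
    x ∈ IsLocalRing.maximalIdeal ℤ_[p] ↔ (p : ℤ_[p]) ∣ x := by
  rw [PadicInt.maximalIdeal_eq_span_p, Ideal.mem_span_singleton]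

/-- **Lemma 7.2 over `ℤ_p`, `p ≠ 2`, `B = ℚ_p`** (Case C: `ε = −1`, alternating; Case D: `ε = 1`, symmetric): two
unimodular `ε`-symmetric matrices over `ℤ_p` that are congruent modulo `p` are `GL_n(ℤ_p)`-equivalent, by a matrix
`g ≡ 1 (mod p)`: `ᵀg J' g = J`. [cite: Kottwitz1992, §7, Lemma 7.2 and its proof, pp. 395–396] -/
theorem exists_isometry_padicInt (hp : p ≠ 2) {ε : ℤ_[p]} {J J' : Matrix n n ℤ_[p]} (hJ : IsUnit J.det)
    (hJε : Jᵀ = ε • J) (hJ'ε : J'ᵀ = ε • J') (hJJ' : ∀ i j, (p : ℤ_[p]) ∣ (J' - J) i j) :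
    ∃ g : Matrix n n ℤ_[p], IsUnit g.det ∧ (∀ i j, (p : ℤ_[p]) ∣ (g - 1) i j) ∧ gᵀ * J' * g = J := by
  obtain ⟨g, hgu, hg1, hgJ⟩ := exists_isometry_of_sub_mem_transpose (I := IsLocalRing.maximalIdeal ℤ_[p])
    (isUnit_two_padicInt hp) hJ hJε hJ'ε (fun i j => mem_maximalIdeal_padicInt_iff.2 (hJJ' i j))
  exact ⟨g, hgu, fun i j => mem_maximalIdeal_padicInt_iff.1 (hg1 i j), hgJ⟩

/-- **Lemma 7.2 over `ℤ_p`, two-stage form**: if `J` is unimodular, `J`, `J'` are `ε`-symmetric, and some integral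
`g₀` transports `J'` to `J` modulo `p` (`ᵀg₀ J' g₀ ≡ J (mod p)`), then `ᵀg J' g = J` for some `g ∈ GL_n(ℤ_p)` with
`g ≡ g₀ (mod p)` («Choose an isomorphism `Λ/pΛ → Λ'/pΛ'` of skew-Hermitian modules … we eventually get … an isomorphism
of skew-Hermitian modules»). [cite: Kottwitz1992, §7, Lemma 7.2 and its proof, pp. 395–396] -/
theorem exists_isometry_padicInt_of_conj_dvd (hp : p ≠ 2) {ε : ℤ_[p]} {J J' : Matrix n n ℤ_[p]}
    (hJ : IsUnit J.det) (hJε : Jᵀ = ε • J) (hJ'ε : J'ᵀ = ε • J') {g₀ : Matrix n n ℤ_[p]}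
    (hg₀ : ∀ i j, (p : ℤ_[p]) ∣ (g₀ᵀ * J' * g₀ - J) i j) :
    ∃ g : Matrix n n ℤ_[p], IsUnit g.det ∧ (∀ i j, (p : ℤ_[p]) ∣ (g - g₀) i j) ∧ gᵀ * J' * g = J := by
  obtain ⟨g, hgu, hg1, hgJ⟩ := exists_isometry_of_conj_sub_mem_transpose (I := IsLocalRing.maximalIdeal ℤ_[p])
    (isUnit_two_padicInt hp) hJ hJε hJ'ε (g₀ := g₀) (fun i j => mem_maximalIdeal_padicInt_iff.2 (hg₀ i j))
  exact ⟨g, hgu, fun i j => mem_maximalIdeal_padicInt_iff.1 (hg1 i j), hgJ⟩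

end PadicInt


/-! ## §6 The iteration abstractly: any solver of the step equation gives the limit

Kottwitz's proof separates the ITERATION («Continuing this process for `p², p³, …`») from the SOLUTION OF ONE STEP
(the equation `(ρ − 1)/p ≡ Ψ + Ψ*` modulo `p`), which he solves in three different ways according to the case
(`p ≠ 2`; `p = 2` Case A; `p = 2` Case C).  We record the iteration once, for an arbitrary step solver and an
arbitrary congruence-stable side condition `P` on the form (e.g. `ε`-hermitian; alternating). -/

section AbstractLimit

variable [Fintype n] [DecidableEq n] {I : Ideal R} [IsAdicComplete I R] (σ : R →+* R)

/-- **The Newton iteration of Lemma 7.2, abstractly** («Continuing this process for `p², p³, …`, we eventually get `Ψ`»):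
let `R` be `I`-adically complete and separated, `σ(I) ⊆ I`, and let `P` be a property of matrices stable under every
transport `X ↦ h† X h` and satisfied by `J'`.  Suppose that for every ideal `K` with `σ(K) ⊆ K` and every `X` with
`P X` and `X ≡ J (mod K)` entrywise, ONE STEP can be solved: some `h ≡ 1 (mod K)` has `h† X h ≡ J (mod K²)`.  If
`J' ≡ J (mod I)`, then `g† J' g = J` for some `g ≡ 1 (mod I)`.  (Iterates `G₀ = 1`, `G_{m+1} = G_m h_m` with `h_m` a
step for `X = G_m† J' G_m` and `K = I^{m+1}`; they converge entrywise by `IsPrecomplete`, and the limit is exact by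
`IsHausdorff`.) [cite: Kottwitz1992, §7, proof of Lemma 7.2, p. 396] -/
theorem exists_conj_eq_of_forall_step (hσI : ∀ a ∈ I, σ a ∈ I) {J J' : Matrix n n R} {P : Matrix n n R → Prop}
    (hP : P J') (hPconj : ∀ X h : Matrix n n R, P X → P ((h.map σ)ᵀ * X * h))
    (step : ∀ K : Ideal R, (∀ a ∈ K, σ a ∈ K) → ∀ X : Matrix n n R, P X → (∀ i j, (X - J) i j ∈ K) →
      ∃ h : Matrix n n R, (∀ i j, (h - 1) i j ∈ K) ∧ ∀ i j, ((h.map σ)ᵀ * X * h - J) i j ∈ K * K)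
    (hJJ' : ∀ i j, (J' - J) i j ∈ I) :
    ∃ g : Matrix n n R, (∀ i j, (g - 1) i j ∈ I) ∧ (g.map σ)ᵀ * J' * g = J := by
  -- the transported form `F g = g† J' g`
  obtain ⟨F, hF⟩ : ∃ F : Matrix n n R → Matrix n n R, ∀ g, F g = (g.map σ)ᵀ * J' * g := ⟨_, fun _ => rfl⟩
  have hF_mul : ∀ g h : Matrix n n R, F (g * h) = (h.map σ)ᵀ * F g * h := by
    intro g h
    simp only [hF, adj_mul, Matrix.mul_assoc]
  -- a total step function `Φ m X` (the step for `K = I^(m+1)` whenever it applies, anything otherwise)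
  have step' : ∀ (m : ℕ) (X : Matrix n n R), ∃ h : Matrix n n R,
      (P X ∧ ∀ i j, (X - J) i j ∈ I ^ (m + 1)) →
        (∀ i j, (h - 1) i j ∈ I ^ (m + 1)) ∧ ∀ i j, ((h.map σ)ᵀ * X * h - J) i j ∈ I ^ (m + 1 + 1) := by
    intro m X
    by_cases hX : P X ∧ ∀ i j, (X - J) i j ∈ I ^ (m + 1)
    · obtain ⟨h, h1, h2⟩ := step (I ^ (m + 1)) (map_mem_pow σ hσI (m + 1)) X hX.1 hX.2
      refine ⟨h, fun _ => ⟨h1, fun i j => ?_⟩⟩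
      have hle : I ^ (m + 1) * I ^ (m + 1) ≤ I ^ (m + 1 + 1) := by
        rw [← pow_add]
        exact Ideal.pow_le_pow_right (by omega)
      exact hle (h2 i j)
    · exact ⟨1, fun h => absurd h hX⟩
  choose Φ hΦ using step'
  obtain ⟨G, hG0, hGs⟩ : ∃ G : ℕ → Matrix n n R, G 0 = 1 ∧ ∀ m, G (m + 1) = G m * Φ m (F (G m)) :=
    ⟨fun m => Nat.rec (motive := fun _ => Matrix n n R) 1 (fun k g => g * Φ k (F g)) m, rfl, fun _ => rfl⟩
  -- invariants of the iteration: `P (F (G m))` and `F (G m) ≡ J (mod I^(m+1))`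
  have hinv : ∀ m, P (F (G m)) ∧ ∀ i j, (F (G m) - J) i j ∈ I ^ (m + 1) := by
    intro m
    induction m with
    | zero =>
      have e : F (G 0) = J' := by rw [hG0, hF, adj_one, Matrix.one_mul, Matrix.mul_one]
      rw [e, zero_add, pow_one]
      exact ⟨hP, hJJ'⟩
    | succ m ih =>
      rw [hGs, hF_mul]
      exact ⟨hPconj _ _ ih.1, (hΦ m (F (G m)) ih).2⟩
  have hcong : ∀ m, ∀ i j, (F (G m) - J) i j ∈ I ^ (m + 1) := fun m => (hinv m).2
  have hdiff : ∀ m, ∀ i j, (G (m + 1) - G m) i j ∈ I ^ (m + 1) := by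
    intro m
    have e : G (m + 1) - G m = G m * (Φ m (F (G m)) - 1) := by
      rw [hGs, Matrix.mul_sub, Matrix.mul_one]
    rw [e]
    exact ent_mul_left _ (hΦ m (F (G m)) (hinv m)).1
  -- the Cauchy estimate `G (m + k) ≡ G m (mod I^(m+1))`
  have hcauchy : ∀ m k, ∀ i j, (G (m + k) - G m) i j ∈ I ^ (m + 1) := by
    intro m k
    induction k with
    | zero =>
      intro i j
      rw [add_zero, sub_self, Matrix.zero_apply]
      exact Ideal.zero_mem _
    | succ k ih =>
      have e : G (m + (k + 1)) - G m = (G (m + k + 1) - G (m + k)) + (G (m + k) - G m) := by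
        rw [← add_assoc, sub_add_sub_cancel]
      rw [e]
      exact ent_add (ent_mono (Ideal.pow_le_pow_right (by omega)) (hdiff (m + k))) ih
  -- the entrywise limit
  have hlim : ∀ i j, ∃ l : R, ∀ m, G m i j - l ∈ I ^ m := by
    intro i j
    obtain ⟨l, hl⟩ := IsPrecomplete.prec' (I := I) (fun m => G m i j) (fun {m k} hmk => by
      obtain ⟨d, rfl⟩ := Nat.exists_eq_add_of_le hmk
      rw [smodEq_iff, ← neg_sub, neg_mem_iff, ← Matrix.sub_apply]
      exact Ideal.pow_le_pow_right (Nat.le_succ m) (hcauchy m d i j))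
    exact ⟨l, fun m => smodEq_iff.1 (hl m)⟩
  choose l hl using hlim
  have happrox : ∀ m, ∀ i j, (Matrix.of l - G m) i j ∈ I ^ m := by
    intro m i j
    rw [Matrix.sub_apply, Matrix.of_apply, ← neg_sub, neg_mem_iff]
    exact hl i j m
  refine ⟨Matrix.of l, ?_, ?_⟩
  · -- `g ≡ 1 (mod I)`
    have e : Matrix.of l - 1 = (Matrix.of l - G 1) + (G (0 + 1) - G 0) := by
      rw [zero_add, hG0, sub_add_sub_cancel]
    rw [e]
    exact ent_add (ent_mono (by rw [pow_one]) (happrox 1)) (ent_mono (by rw [zero_add, pow_one]) (hdiff 0))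
  · -- `g† J' g = J` exactly, by separatedness
    ext i j
    rw [← sub_eq_zero, ← Matrix.sub_apply]
    refine IsHausdorff.haus' (I := I) _ fun m => ?_
    rw [SModEq.zero, smul_eq_mul, Ideal.mul_top]
    have key : ((Matrix.of l).map σ)ᵀ * J' * Matrix.of l - J = (F (G m) - J) +
        (((Matrix.of l - G m).map σ)ᵀ * J' * Matrix.of l + ((G m).map σ)ᵀ * J' * (Matrix.of l - G m)) := by
      rw [hF, adj_sub]
      noncomm_ring
    rw [key]
    exact ent_add (ent_mono (Ideal.pow_le_pow_right (Nat.le_succ m)) (hcong m))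
      (ent_add (ent_mul_right _ (ent_mul_right _ (ent_transpose (ent_map σ (map_mem_pow σ hσI m) (happrox m)))))
        (ent_mul_left _ (happrox m))) i j

end AbstractLimit

/-! ## §7 The step under a surjective trace: `ψ = −t J⁻¹(J' − J)` with `t + σ t = 1` (Case A at `p = 2`) -/

section Trace

variable [Fintype n] [DecidableEq n] (σ : R →+* R) {K : Ideal R}

/-- **The approximation step when the trace hits `1`** («If `p = 2` and we are in Case A, it is again obvious that this
equation can be solved (use that the trace map from `𝔽_{p²}` to `𝔽_p` is surjective)»): if `t + σ t = 1`, `J` is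
unimodular, `J`, `J'` are `ε`-hermitian and `J' ≡ J (mod K)` entrywise with `σ(K) ⊆ K`, then
`h = 1 − t · J⁻¹(J' − J)` satisfies `h† J' h ≡ J (mod K²)` entrywise: for `ψ = h − 1` one has `ψ† J = −σ(t)(J' − J)` and
`J ψ = −t (J' − J)`, so `ψ† J + J ψ = −(J' − J)`.  No hypothesis on `2`; `t = ½` recovers `conj_sub_mem_mul`.
[cite: Kottwitz1992, §7, proof of Lemma 7.2, p. 396] -/
theorem conj_sub_mem_mul_of_trace (hσK : ∀ a ∈ K, σ a ∈ K) {t : R} (ht : t + σ t = 1) {ε : R} {J J' : Matrix n n R}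
    (hJ : IsUnit J.det) (hJε : (J.map σ)ᵀ = ε • J) (hJ'ε : (J'.map σ)ᵀ = ε • J')
    (hD : ∀ i j, (J' - J) i j ∈ K) (i j : n) :
    (((1 - t • (J⁻¹ * (J' - J))).map σ)ᵀ * J' * (1 - t • (J⁻¹ * (J' - J))) - J) i j ∈ K * K := by
  set D := J' - J with hD_def
  set ψ : Matrix n n R := -(t • (J⁻¹ * D)) with hψ_def
  have hh : (1 : Matrix n n R) - t • (J⁻¹ * D) = 1 + ψ := by rw [hψ_def, sub_eq_add_neg]
  have hDadj : (D.map σ)ᵀ = ε • D := adj_sub_eq σ hJε hJ'ε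
  have hW : ε • ((J⁻¹.map σ)ᵀ * J) = 1 := smul_adj_inv_mul σ hJ hJε
  -- entries of `ψ` and `ψ†`
  have hψK : ∀ i j, ψ i j ∈ K := ent_neg (ent_smul t (ent_mul_left J⁻¹ hD))
  have hψadjK : ∀ i j, (ψ.map σ)ᵀ i j ∈ K := ent_transpose (ent_map σ hσK hψK)
  -- the two halves of `ψ† J + J ψ = -D`
  have hJψ : J * ψ = -(t • D) := by
    rw [hψ_def, Matrix.mul_neg, Matrix.mul_smul, ← Matrix.mul_assoc, Matrix.mul_nonsing_inv _ hJ, Matrix.one_mul]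
  have hψJ : (ψ.map σ)ᵀ * J = -(σ t • D) := by
    have e1 : ψ.map σ = -(σ t • (J⁻¹.map σ * D.map σ)) := by
      rw [hψ_def, Matrix.map_neg _ (map_neg σ), Matrix.map_smul' _ _ _ (map_mul σ), Matrix.map_mul]
    rw [e1, Matrix.transpose_neg, Matrix.transpose_smul, Matrix.transpose_mul, hDadj]
    simp only [Matrix.neg_mul, Matrix.smul_mul, Matrix.mul_assoc]
    rw [← Matrix.mul_smul, hW, Matrix.mul_one]
  have hsum : (ψ.map σ)ᵀ * J + J * ψ = -D := by
    rw [hψJ, hJψ, ← neg_add, ← add_smul, add_comm (σ t) t, ht, one_smul]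
  -- the identity
  have hid : ((1 + ψ).map σ)ᵀ * J' * (1 + ψ) - J = (ψ.map σ)ᵀ * D + D * ψ + (ψ.map σ)ᵀ * J' * ψ := by
    have hJ' : J' = J + D := by rw [hD_def]; abel
    rw [adj_add, adj_one, hJ']
    have key : (1 + (ψ.map σ)ᵀ) * (J + D) * (1 + ψ) - J =
        ((ψ.map σ)ᵀ * J + J * ψ) + D + ((ψ.map σ)ᵀ * D + D * ψ + (ψ.map σ)ᵀ * (J + D) * ψ) := by
      noncomm_ring
    rw [key, hsum, neg_add_cancel, zero_add]
  rw [hh, hid]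
  exact ent_add (ent_add (ent_mul_mul hψadjK hD) (ent_mul_mul hD hψK)) (ent_mul_mul (ent_mul_right J' hψadjK) hψK) i j

/-- **The approximation step under a surjective trace, `∃`-form**: with `t + σ t = 1`, `J` unimodular, `J, J'`
`ε`-hermitian and `J' ≡ J (mod K)`, there is `ψ` with entries in `K` such that `(1 + ψ)† J' (1 + ψ) ≡ J (mod K²)`.
[cite: Kottwitz1992, §7, proof of Lemma 7.2, p. 396] -/
theorem exists_conj_sub_mem_mul_of_trace (hσK : ∀ a ∈ K, σ a ∈ K) {t : R} (ht : t + σ t = 1) {ε : R}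
    {J J' : Matrix n n R} (hJ : IsUnit J.det) (hJε : (J.map σ)ᵀ = ε • J) (hJ'ε : (J'.map σ)ᵀ = ε • J')
    (hD : ∀ i j, (J' - J) i j ∈ K) :
    ∃ ψ : Matrix n n R, (∀ i j, ψ i j ∈ K) ∧
      ∀ i j, (((1 + ψ).map σ)ᵀ * J' * (1 + ψ) - J) i j ∈ K * K := by
  refine ⟨-(t • (J⁻¹ * (J' - J))), ent_neg (ent_smul t (ent_mul_left J⁻¹ hD)), fun i j => ?_⟩
  rw [← sub_eq_add_neg]
  exact conj_sub_mem_mul_of_trace σ hσK ht hJ hJε hJ'ε hD i j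

end Trace

section TraceLimit

variable [Fintype n] [DecidableEq n] {I : Ideal R} [IsAdicComplete I R] (σ : R →+* R)

/-- **Hensel's lemma for `ε`-hermitian forms under a surjective trace** (Lemma 7.2's iteration with the Case-A step,
valid for every `p`, in particular `p = 2`): `R` complete and separated in the `I`-adic topology, `σ` an involution with
`σ(I) ⊆ I`, and some `t ∈ R` with `t + σ t = 1`; if `J` is unimodular, `J† = εJ`, `J'† = εJ'` and `J' ≡ J (mod I)`
entrywise, then `g† J' g = J` for some `g ≡ 1 (mod I)`. [cite: Kottwitz1992, §7, Lemma 7.2 and its proof, pp. 395–396] -/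
theorem exists_conj_eq_of_sub_mem_of_trace (hσ : ∀ a, σ (σ a) = a) (hσI : ∀ a ∈ I, σ a ∈ I) {t : R}
    (ht : t + σ t = 1) {ε : R} {J J' : Matrix n n R} (hJ : IsUnit J.det) (hJε : (J.map σ)ᵀ = ε • J)
    (hJ'ε : (J'.map σ)ᵀ = ε • J') (hJJ' : ∀ i j, (J' - J) i j ∈ I) :
    ∃ g : Matrix n n R, (∀ i j, (g - 1) i j ∈ I) ∧ (g.map σ)ᵀ * J' * g = J :=
  exists_conj_eq_of_forall_step σ hσI (P := fun X => (X.map σ)ᵀ = ε • X) hJ'ε (fun _ h hX => adj_conj σ hσ hX h)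
    (fun K hσK X hX hXJ => ⟨1 - t • (J⁻¹ * (X - J)),
      fun i j => by
        rw [sub_sub_cancel_left]
        exact ent_neg (ent_smul t (ent_mul_left J⁻¹ hXJ)) i j,
      conj_sub_mem_mul_of_trace σ hσK ht hJ hJε hX hXJ⟩) hJJ'

/-- **Hensel's lemma under a surjective trace, with invertibility**: under the hypotheses of
`exists_conj_eq_of_sub_mem_of_trace` there is `g ∈ GL_n(R)`, `g ≡ 1 (mod I)`, with `g† J' g = J`.
[cite: Kottwitz1992, §7, Lemma 7.2 and its proof, pp. 395–396] -/
theorem exists_isometry_of_sub_mem_of_trace (hσ : ∀ a, σ (σ a) = a) (hσI : ∀ a ∈ I, σ a ∈ I) {t : R}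
    (ht : t + σ t = 1) {ε : R} {J J' : Matrix n n R} (hJ : IsUnit J.det) (hJε : (J.map σ)ᵀ = ε • J)
    (hJ'ε : (J'.map σ)ᵀ = ε • J') (hJJ' : ∀ i j, (J' - J) i j ∈ I) :
    ∃ g : Matrix n n R, IsUnit g.det ∧ (∀ i j, (g - 1) i j ∈ I) ∧ (g.map σ)ᵀ * J' * g = J := by
  obtain ⟨g, hg1, hgJ⟩ := exists_conj_eq_of_sub_mem_of_trace σ hσ hσI ht hJ hJε hJ'ε hJJ'
  exact ⟨g, isUnit_det_of_sub_one_mem hg1, hg1, hgJ⟩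

/-- **Two-stage form under a surjective trace**: if `J` is unimodular, `J`, `J'` are `ε`-hermitian, `t + σ t = 1`, and
some `g₀` transports `J'` to `J` MODULO `I` (`g₀† J' g₀ ≡ J`), then some `g ≡ g₀ (mod I)` with `det g ∈ Rˣ` has
`g† J' g = J`. [cite: Kottwitz1992, §7, Lemma 7.2 and its proof, pp. 395–396] -/
theorem exists_isometry_of_conj_sub_mem_of_trace (hσ : ∀ a, σ (σ a) = a) (hσI : ∀ a ∈ I, σ a ∈ I) {t : R}
    (ht : t + σ t = 1) {ε : R} {J J' : Matrix n n R} (hJ : IsUnit J.det) (hJε : (J.map σ)ᵀ = ε • J)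
    (hJ'ε : (J'.map σ)ᵀ = ε • J') {g₀ : Matrix n n R} (hg₀ : ∀ i j, ((g₀.map σ)ᵀ * J' * g₀ - J) i j ∈ I) :
    ∃ g : Matrix n n R, IsUnit g.det ∧ (∀ i j, (g - g₀) i j ∈ I) ∧ (g.map σ)ᵀ * J' * g = J := by
  obtain ⟨h, hh1, hhJ⟩ := exists_conj_eq_of_sub_mem_of_trace σ hσ hσI ht hJ hJε (adj_conj σ hσ hJ'ε g₀) hg₀
  have e : ((g₀ * h).map σ)ᵀ * J' * (g₀ * h) = J := by
    rw [← hhJ]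
    simp only [adj_mul, Matrix.mul_assoc]
  refine ⟨g₀ * h, ?_, ?_, e⟩
  · have hd := congrArg Matrix.det e
    rw [Matrix.det_mul, Matrix.det_mul] at hd
    have hu : IsUnit (((g₀ * h).map σ)ᵀ.det * J'.det * (g₀ * h).det) := by rw [hd]; exact hJ
    exact isUnit_of_mul_isUnit_right hu
  · have e2 : g₀ * h - g₀ = g₀ * (h - 1) := by rw [Matrix.mul_sub, Matrix.mul_one]
    rw [e2]
    exact ent_mul_left _ hh1

end TraceLimit

/-! ### When does the trace hit `1`?  (`2 ∈ Rˣ`; a `σ`-moved unit of the residue field; the split algebra `A × A`) -/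

section TraceWitness

variable (σ : R →+* R)

/-- `2u = 1` forces `σ u = u`, hence `u + σ u = 1`: the case `2 ∈ Rˣ` of §2–§3 («take `Ψ` to be `½` times the symmetric
element») is the case `t = ½` of §7. [cite: Kottwitz1992, §7, proof of Lemma 7.2, p. 396] -/
theorem add_map_eq_one_of_two_mul_eq_one {u : R} (hu : 2 * u = 1) : u + σ u = 1 := by
  have h := congrArg σ hu
  rw [map_mul, map_ofNat, map_one] at h
  have hσu : σ u = u :=
    calc σ u = σ u * (2 * u) := by rw [hu, mul_one]
      _ = 2 * σ u * u := by ring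
      _ = u := by rw [h, one_mul]
  rw [hσu, ← two_mul, hu]

/-- if `2 ∈ Rˣ` then `t + σ t = 1` is solvable (`t = ½`: «If `p ≠ 2`, it is obvious that this equation can be solved»).
[cite: Kottwitz1992, §7, proof of Lemma 7.2, p. 396] -/
theorem exists_add_map_eq_one_of_isUnit_two (h2 : IsUnit (2 : R)) : ∃ t : R, t + σ t = 1 := by
  obtain ⟨u, hu⟩ := h2.exists_right_inv
  exact ⟨u, add_map_eq_one_of_two_mul_eq_one σ hu⟩

/-- **The trace hits `1` as soon as it hits a unit**: for an involution `σ`, if `a + σ a` is a unit then `t + σ t = 1`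
for `t = a · (a + σ a)⁻¹` (the inverse of the `σ`-fixed unit `a + σ a` is `σ`-fixed).  Over the valuation ring of an
unramified quadratic extension of local fields the trace is onto [Serre1979, Ch. V §2], which is Kottwitz's «the trace
map from `𝔽_{p²}` to `𝔽_p` is surjective» lifted from the residue field to an exact solution.
[cite: Kottwitz1992, §7, proof of Lemma 7.2, p. 396] -/
theorem exists_add_map_eq_one_of_isUnit_add (hσ : ∀ a, σ (σ a) = a) {a : R} (ha : IsUnit (a + σ a)) :
    ∃ t : R, t + σ t = 1 := by
  obtain ⟨w, hw⟩ := ha.exists_right_inv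
  have hs : σ (a + σ a) = a + σ a := by rw [map_add, hσ, add_comm]
  have hσw : σ w = w := by
    have h := congrArg σ hw
    rw [map_mul, hs, map_one] at h
    calc σ w = σ w * ((a + σ a) * w) := by rw [hw, mul_one]
      _ = (a + σ a) * σ w * w := by ring
      _ = w := by rw [h, one_mul]
  refine ⟨a * w, ?_⟩
  rw [map_mul, hσw, ← add_mul, hw]

/-- **Local rings: a `σ`-moved unit suffices** — if `R` is local, `σ` an involution and `σ a − a ∈ Rˣ` for some `a`
(i.e. `σ` is not the identity on the residue field), then `t + σ t = 1` is solvable: either `2 ∈ Rˣ`, or `2 ∈ 𝔪` and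
then `a + σ a = (σ a − a) + 2a` is a unit.  (The dyadic Case A: `R = W(𝔽_4) = ℤ_2[ω]`, `σ ω − ω = ω² − ω` a unit; «use
that the trace map from `𝔽_{p²}` to `𝔽_p` is surjective».) [cite: Kottwitz1992, §7, proof of Lemma 7.2, p. 396] -/
theorem exists_add_map_eq_one_of_isUnit_sub [IsLocalRing R] (hσ : ∀ a, σ (σ a) = a) {a : R}
    (ha : IsUnit (σ a - a)) : ∃ t : R, t + σ t = 1 := by
  by_cases h2 : IsUnit (2 : R)
  · exact exists_add_map_eq_one_of_isUnit_two σ h2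
  · have h2m : (2 : R) ∈ IsLocalRing.maximalIdeal R := (IsLocalRing.mem_maximalIdeal _).2 (mem_nonunits_iff.2 h2)
    have hsum : IsUnit (σ a - a + 2 * a) := by
      by_contra hn
      have hm : σ a - a + 2 * a ∈ IsLocalRing.maximalIdeal R :=
        (IsLocalRing.mem_maximalIdeal _).2 (mem_nonunits_iff.2 hn)
      have hm' : σ a - a ∈ IsLocalRing.maximalIdeal R := by
        have h := Ideal.sub_mem _ hm (Ideal.mul_mem_right a _ h2m)
        rwa [add_sub_cancel_right] at h
      exact (mem_nonunits_iff.1 ((IsLocalRing.mem_maximalIdeal _).1 hm')) ha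
    have e : σ a - a + 2 * a = a + σ a := by ring
    rw [e] at hsum
    exact exists_add_map_eq_one_of_isUnit_add σ hσ hsum

/-- **The split algebra** (Case A at a prime split in the imaginary quadratic field: `𝒪 ⊗ ℤ_p = ℤ_p × ℤ_p` with the
involution exchanging the factors, [Kottwitz1992, §7, p. 395]: «the `ℚ_p`-algebra `F` is a finite product of finite unramified
extensions of `ℚ_p`»): on `A × A` with the swap `σ = prodComm`, `t = (1, 0)` has `t + σ t = 1`, so §7 applies verbatim.
[cite: Kottwitz1992, §7, proof of Lemma 7.2, pp. 395–396] -/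
theorem exists_add_prodComm_eq_one {A : Type*} [CommRing A] :
    ∃ t : A × A, t + (RingEquiv.prodComm : A × A ≃+* A × A) t = 1 :=
  ⟨(1, 0), Prod.ext (by simp) (by simp)⟩

end TraceWitness

/-! ## §8 The step for ALTERNATING forms without dividing by `2` (Case C at `p = 2`): `J' − J = N − ᵀN`

«If `p = 2` and we are in Case C, it is not true that the map `x ↦ x + x*` from `C₀/pC₀` to `(C₀/pC₀)^sym` is
surjective; however, it is true that its image contains `(C₀)^sym/p(C₀)^sym`.»  In coordinates (`σ = id`, `ε = −1`, `B = F`):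
the difference `D = J' − J` of two ALTERNATING matrices is alternating, hence of the form `N − ᵀN` (`N` = the part of `D`
above the diagonal, for any ordering of the indices), and `ψ = J⁻¹ ᵀN` solves `ᵀψ J + J ψ = −D` exactly. -/

section Alternating

variable [Fintype n] [DecidableEq n] {K : Ideal R}

omit [DecidableEq n] in
/-- [folklore] a congruence `ᵀh X h` of a skew matrix is skew. -/
private theorem transpose_conj_eq_neg {X : Matrix n n R} (hX : Xᵀ = -X) (h : Matrix n n R) :
    (hᵀ * X * h)ᵀ = -(hᵀ * X * h) := by
  rw [Matrix.transpose_mul, Matrix.transpose_mul, Matrix.transpose_transpose, hX, Matrix.neg_mul, Matrix.mul_neg,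
    Matrix.mul_assoc]

omit [DecidableEq n] in
/-- [folklore] a congruence `ᵀh X h` of an alternating matrix has zero diagonal (the summand `h a k · X a b · h b k` is
antisymmetric in `(a, b)` and vanishes for `a = b`). -/
private theorem conj_apply_self_eq_zero {X : Matrix n n R} (hX : Xᵀ = -X) (hd : ∀ i, X i i = 0) (h : Matrix n n R)
    (k : n) : (hᵀ * X * h) k k = 0 := by
  have halt : ∀ x y, X y x = -X x y := fun x y => by
    simpa using congrFun (congrFun hX x) y
  rw [Matrix.mul_apply]
  simp_rw [Matrix.mul_apply, Matrix.transpose_apply, Finset.sum_mul]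
  rw [← Finset.sum_product']
  refine Finset.sum_involution (fun p _ => (p.2, p.1)) ?_ ?_ ?_ ?_
  · rintro ⟨a, b⟩ _
    simp only [halt a b]
    ring
  · rintro ⟨a, b⟩ _ hne h
    simp only [Prod.mk.injEq] at h
    apply hne
    simp only [h.1, hd, mul_zero, zero_mul]
  · rintro ⟨a, b⟩ _
    simp
  · rintro ⟨a, b⟩ _
    rfl

/-- **The approximation step for alternating forms, any `2`** (Kottwitz's Case C at `p = 2`, «its image contains
`(C₀)^sym/p(C₀)^sym`»): if `J` is unimodular, `J`, `J'` are ALTERNATING (`ᵀJ = −J` with zero diagonal) and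
`J' ≡ J (mod K)` entrywise, then some `ψ` with entries in `K` has `ᵀ(1 + ψ) J' (1 + ψ) ≡ J (mod K²)` entrywise — namely
`ψ = J⁻¹ ᵀN` where `J' − J = N − ᵀN` with `N` the strictly-upper part of `J' − J` in an ordering of the indices
(`ᵀψ J = −N`, `J ψ = ᵀN`). [cite: Kottwitz1992, §7, proof of Lemma 7.2, p. 396] -/
theorem exists_conj_sub_mem_mul_of_alternating {J J' : Matrix n n R} (hJ : IsUnit J.det) (hJs : Jᵀ = -J)
    (hJd : ∀ i, J i i = 0) (hJ's : J'ᵀ = -J') (hJ'd : ∀ i, J' i i = 0) (hD : ∀ i j, (J' - J) i j ∈ K) :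
    ∃ ψ : Matrix n n R, (∀ i j, ψ i j ∈ K) ∧ ∀ i j, (((1 : Matrix n n R) + ψ)ᵀ * J' * (1 + ψ) - J) i j ∈ K * K := by
  set D := J' - J with hD_def
  have hDs : ∀ i j, D j i = -D i j := fun i j => by
    have h := congrFun (congrFun (show Dᵀ = -D by rw [hD_def, Matrix.transpose_sub, hJs, hJ's]; abel) i) j
    simpa using h
  have hDd : ∀ i, D i i = 0 := fun i => by rw [hD_def, Matrix.sub_apply, hJd, hJ'd, sub_zero]
  -- `D = N − ᵀN` with `N` the part of `D` above the diagonal for the ordering transported from `Fin (card n)`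
  obtain ⟨e⟩ : Nonempty (n ≃ Fin (Fintype.card n)) := ⟨Fintype.equivFin n⟩
  set N : Matrix n n R := Matrix.of fun i j => if e i < e j then D i j else 0 with hN_def
  have hNK : ∀ i j, N i j ∈ K := fun i j => by
    rw [hN_def, Matrix.of_apply]
    split_ifs
    · exact hD i j
    · exact K.zero_mem
  have hND : Nᵀ - N = -D := by
    ext i j
    rw [Matrix.sub_apply, Matrix.transpose_apply, hN_def, Matrix.of_apply, Matrix.of_apply, Matrix.neg_apply]
    rcases lt_trichotomy (e i) (e j) with hlt | heq | hgt
    · rw [if_neg (not_lt.2 hlt.le), if_pos hlt, zero_sub]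
    · rw [e.injective heq, if_neg (lt_irrefl _), sub_self, hDd, neg_zero]
    · rw [if_pos hgt, if_neg (not_lt.2 hgt.le), sub_zero, hDs]
  -- `ψ = J⁻¹ ᵀN`
  set ψ : Matrix n n R := J⁻¹ * Nᵀ with hψ_def
  have hψK : ∀ i j, ψ i j ∈ K := ent_mul_left J⁻¹ (ent_transpose hNK)
  have hψtK : ∀ i j, ψᵀ i j ∈ K := ent_transpose hψK
  have hW : (J⁻¹)ᵀ * J = -1 := by
    have h := congrArg Matrix.transpose (Matrix.mul_nonsing_inv J hJ)
    rw [Matrix.transpose_mul, Matrix.transpose_one, hJs, Matrix.mul_neg] at h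
    rw [← neg_neg ((J⁻¹)ᵀ * J), h]
  have hJψ : J * ψ = Nᵀ := by
    rw [hψ_def, ← Matrix.mul_assoc, Matrix.mul_nonsing_inv _ hJ, Matrix.one_mul]
  have hψJ : ψᵀ * J = -N := by
    rw [hψ_def, Matrix.transpose_mul, Matrix.transpose_transpose, Matrix.mul_assoc, hW, Matrix.mul_neg, Matrix.mul_one]
  have hsum : ψᵀ * J + J * ψ = -D := by
    rw [hψJ, hJψ, ← hND]
    abel
  have hid : (1 + ψ)ᵀ * J' * (1 + ψ) - J = ψᵀ * D + D * ψ + ψᵀ * J' * ψ := by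
    have hJ' : J' = J + D := by rw [hD_def]; abel
    rw [Matrix.transpose_add, Matrix.transpose_one, hJ']
    have key : (1 + ψᵀ) * (J + D) * (1 + ψ) - J = (ψᵀ * J + J * ψ) + D + (ψᵀ * D + D * ψ + ψᵀ * (J + D) * ψ) := by
      noncomm_ring
    rw [key, hsum, neg_add_cancel, zero_add]
  refine ⟨ψ, hψK, fun i j => ?_⟩
  rw [hid]
  exact ent_add (ent_add (ent_mul_mul hψtK hD) (ent_mul_mul hD hψK)) (ent_mul_mul (ent_mul_right J' hψtK) hψK) i j

end Alternating

section AlternatingLimit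

variable [Fintype n] [DecidableEq n] {I : Ideal R} [IsAdicComplete I R]

/-- **Hensel's lemma for ALTERNATING forms over any adically complete ring, `2` arbitrary** (Lemma 7.2, Case C with
`B = F`, now including `p = 2`): if `J` is unimodular, `J`, `J'` are alternating (`ᵀJ = −J`, zero diagonal) and
`J' ≡ J (mod I)` entrywise, then `ᵀg J' g = J` for some `g ≡ 1 (mod I)`.
[cite: Kottwitz1992, §7, Lemma 7.2 and its proof, pp. 395–396] -/
theorem exists_conj_eq_of_sub_mem_of_alternating {J J' : Matrix n n R} (hJ : IsUnit J.det) (hJs : Jᵀ = -J)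
    (hJd : ∀ i, J i i = 0) (hJ's : J'ᵀ = -J') (hJ'd : ∀ i, J' i i = 0) (hJJ' : ∀ i j, (J' - J) i j ∈ I) :
    ∃ g : Matrix n n R, (∀ i j, (g - 1) i j ∈ I) ∧ gᵀ * J' * g = J := by
  obtain ⟨g, hg1, hgJ⟩ := exists_conj_eq_of_forall_step (RingHom.id R) (fun _ h => h)
    (P := fun X => Xᵀ = -X ∧ ∀ i, X i i = 0) ⟨hJ's, hJ'd⟩
    (fun X h hX => by
      rw [map_ringHom_id]
      exact ⟨transpose_conj_eq_neg hX.1 h, conj_apply_self_eq_zero hX.1 hX.2 h⟩)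
    (fun K _ X hX hXJ => by
      obtain ⟨ψ, hψK, hψ⟩ := exists_conj_sub_mem_mul_of_alternating (K := K) hJ hJs hJd hX.1 hX.2 hXJ
      refine ⟨1 + ψ, fun i j => by rw [add_sub_cancel_left]; exact hψK i j, fun i j => ?_⟩
      rw [map_ringHom_id]
      exact hψ i j)
    hJJ'
  rw [map_ringHom_id] at hgJ
  exact ⟨g, hg1, hgJ⟩

/-- **Hensel's lemma for alternating forms, with invertibility**: the `g ≡ 1 (mod I)` of
`exists_conj_eq_of_sub_mem_of_alternating` lies in `GL_n(R)`. [cite: Kottwitz1992, §7, Lemma 7.2 and its proof, pp. 395–396] -/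
theorem exists_isometry_of_sub_mem_of_alternating {J J' : Matrix n n R} (hJ : IsUnit J.det) (hJs : Jᵀ = -J)
    (hJd : ∀ i, J i i = 0) (hJ's : J'ᵀ = -J') (hJ'd : ∀ i, J' i i = 0) (hJJ' : ∀ i j, (J' - J) i j ∈ I) :
    ∃ g : Matrix n n R, IsUnit g.det ∧ (∀ i j, (g - 1) i j ∈ I) ∧ gᵀ * J' * g = J := by
  obtain ⟨g, hg1, hgJ⟩ := exists_conj_eq_of_sub_mem_of_alternating hJ hJs hJd hJ's hJ'd hJJ'
  exact ⟨g, isUnit_det_of_sub_one_mem hg1, hg1, hgJ⟩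

/-- **Two-stage form for alternating forms**: if `J` is unimodular, `J`, `J'` alternating, and some `g₀` transports `J'`
to `J` modulo `I` (`ᵀg₀ J' g₀ ≡ J`), then `ᵀg J' g = J` for some `g ∈ GL_n(R)` with `g ≡ g₀ (mod I)` — no hypothesis
on `2`. [cite: Kottwitz1992, §7, Lemma 7.2 and its proof, pp. 395–396] -/
theorem exists_isometry_of_conj_sub_mem_of_alternating {J J' : Matrix n n R} (hJ : IsUnit J.det) (hJs : Jᵀ = -J)
    (hJd : ∀ i, J i i = 0) (hJ's : J'ᵀ = -J') (hJ'd : ∀ i, J' i i = 0) {g₀ : Matrix n n R}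
    (hg₀ : ∀ i j, (g₀ᵀ * J' * g₀ - J) i j ∈ I) :
    ∃ g : Matrix n n R, IsUnit g.det ∧ (∀ i j, (g - g₀) i j ∈ I) ∧ gᵀ * J' * g = J := by
  obtain ⟨h, hh1, hhJ⟩ := exists_conj_eq_of_sub_mem_of_alternating (I := I) hJ hJs hJd
    (transpose_conj_eq_neg hJ's g₀) (conj_apply_self_eq_zero hJ's hJ'd g₀) hg₀
  have e : (g₀ * h)ᵀ * J' * (g₀ * h) = J := by
    rw [← hhJ]
    simp only [Matrix.transpose_mul, Matrix.mul_assoc]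
  refine ⟨g₀ * h, ?_, ?_, e⟩
  · have hd := congrArg Matrix.det e
    rw [Matrix.det_mul, Matrix.det_mul] at hd
    have hu : IsUnit ((g₀ * h)ᵀ.det * J'.det * (g₀ * h).det) := by rw [hd]; exact hJ
    exact isUnit_of_mul_isUnit_right hu
  · have e2 : g₀ * h - g₀ = g₀ * (h - 1) := by rw [Matrix.mul_sub, Matrix.mul_one]
    rw [e2]
    exact ent_mul_left _ hh1

end AlternatingLimit

section PadicIntTwo

variable [Fintype n] [DecidableEq n] {p : ℕ} [Fact p.Prime]

/-- **Lemma 7.2 over `ℤ_p` for alternating forms, ALL primes `p` (including `p = 2`)**: two unimodular alternating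
matrices over `ℤ_p` that are congruent modulo `p` are `GL_n(ℤ_p)`-equivalent by a matrix `g ≡ 1 (mod p)`:
`ᵀg J' g = J`. [cite: Kottwitz1992, §7, Lemma 7.2 and its proof, pp. 395–396] -/
theorem exists_isometry_padicInt_of_alternating {J J' : Matrix n n ℤ_[p]} (hJ : IsUnit J.det) (hJs : Jᵀ = -J)
    (hJd : ∀ i, J i i = 0) (hJ's : J'ᵀ = -J') (hJ'd : ∀ i, J' i i = 0)
    (hJJ' : ∀ i j, (p : ℤ_[p]) ∣ (J' - J) i j) :
    ∃ g : Matrix n n ℤ_[p], IsUnit g.det ∧ (∀ i j, (p : ℤ_[p]) ∣ (g - 1) i j) ∧ gᵀ * J' * g = J := by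
  obtain ⟨g, hgu, hg1, hgJ⟩ := exists_isometry_of_sub_mem_of_alternating (I := IsLocalRing.maximalIdeal ℤ_[p])
    hJ hJs hJd hJ's hJ'd (fun i j => mem_maximalIdeal_padicInt_iff.2 (hJJ' i j))
  exact ⟨g, hgu, fun i j => mem_maximalIdeal_padicInt_iff.1 (hg1 i j), hgJ⟩

/-- **Lemma 7.2 over `ℤ_p` for alternating forms, two-stage form, all `p`**: if `J` is unimodular, `J`, `J'` alternating,
and some integral `g₀` has `ᵀg₀ J' g₀ ≡ J (mod p)`, then `ᵀg J' g = J` for some `g ∈ GL_n(ℤ_p)` with `g ≡ g₀ (mod p)`.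
[cite: Kottwitz1992, §7, Lemma 7.2 and its proof, pp. 395–396] -/
theorem exists_isometry_padicInt_of_alternating_of_conj_dvd {J J' : Matrix n n ℤ_[p]} (hJ : IsUnit J.det)
    (hJs : Jᵀ = -J) (hJd : ∀ i, J i i = 0) (hJ's : J'ᵀ = -J') (hJ'd : ∀ i, J' i i = 0) {g₀ : Matrix n n ℤ_[p]}
    (hg₀ : ∀ i j, (p : ℤ_[p]) ∣ (g₀ᵀ * J' * g₀ - J) i j) :
    ∃ g : Matrix n n ℤ_[p], IsUnit g.det ∧ (∀ i j, (p : ℤ_[p]) ∣ (g - g₀) i j) ∧ gᵀ * J' * g = J := by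
  obtain ⟨g, hgu, hg1, hgJ⟩ := exists_isometry_of_conj_sub_mem_of_alternating (I := IsLocalRing.maximalIdeal ℤ_[p])
    hJ hJs hJd hJ's hJ'd (g₀ := g₀) (fun i j => mem_maximalIdeal_padicInt_iff.2 (hg₀ i j))
  exact ⟨g, hgu, fun i j => mem_maximalIdeal_padicInt_iff.1 (hg1 i j), hgJ⟩

end PadicIntTwo

end Literature.LinearAlgebra.Matrix.HermitianFormsHensel
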